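import Summits.NavierStokesRegularity.NavierStokesRegularity.Theses.HiddenConvexityPressureFloor
import HarnessLib.Audit

/-!
# Birth skeleton (BC3) of the crux `HiddenConvexityPressureFloor.FinitelyManyTurnovers`

(crux item `stmt-NavierStokesRegularity-2961`, rank 2 = the route's hardest item, route
`route-NavierStokesRegularity-HiddenConvexityPressureFloor`; tree path
`Cruxes/FinitelyManyTurnovers/Lines/birth.lean`; registrar `planner-skel-stmt-NavierStokesRegularity-2961-0`,
2026-08-17. The route (opened 2026-08-15) predates the Lean birth certificate; this file supplies BC3
retroactively.)

THE CRUX `P = FinitelyManyTurnovers`. For `ν > 0`, `T > 0` and every classical solution `(u, p)` of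
unforced Navier–Stokes on `ℝ³ × [0,T)` that is Leray–Hopf on `[0,T]` from a rapidly decaying datum
`u 0`, there is a SEMICONCAVITY MODULUS `k ≥ 0` of the normalised pressure — `x ↦ p̃(t,x) − k(t)/2·‖x‖²`
concave for every `t ∈ [0,T)`, `p̃(t) = normalisedPressure (u t) = −Δ⁻¹∂ᵢ∂ⱼ(uᵢuⱼ)` — with
`∫₀ᵀ √k dt < ∞` ("[0,T) is covered by finitely many least-action time units": a Brenier / ACLZ
minimality window from `t` has length `≥ π/√(sup k)`). `√k` is a FREQUENCY (dimension time⁻¹, like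
BKM's `‖ω‖∞`); the statement is scale-invariant, and its content sits at the final time `T`.

THE CUT (three stubs, three proof worlds; composition `FinitelyManyTurnovers_of` closed).
The modulus is assembled from a BOUNDED modulus strictly before the final time and a SUB-SELF-SIMILAR
envelope on a terminal layer:

* `stub_aprioriBoundsBeforeT` [L, KNOWN-type — Clay-class a-priori regularity strictly before the
  final time]: for the crux's frame and every `T' < T` there is one constant `M` bounding
  `‖Dⁿ(u t)(x)‖` (`n ≤ 3`, all `x ∈ ℝ³`) and the energy `∫ |u t|²` for all `t ∈ [0,T']`. Content:
  the classical Leray–Hopf solution coincides (a.e., hence pointwise by continuity) with the Kato /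
  `H^∞` solution from `u 0` as long as the latter lives; its maximal time is `≥ T` because a finite
  Kato maximal time `T* < T` carries a singular point `(T*, x₁)` (Lemarié-Rieusset 2016 Thm 15.1 (C),
  in tree `lemarieRieusset_singular_point_of_blowup_holds`) at which `u` is nevertheless continuous —
  the same bookkeeping as the route's proved assembly `typeICertificateLadder_noBlowupToClay_proof` —
  and `H^∞` data propagate to `C([0,T']; Hᵐ)` for every `m` (Sobolev ⇒ `C³_b`), energy by the
  Leray–Hopf inequality (`IsLerayHopfOn.energy_ineq_zero`). UNIFORMITY IN `x` is the point: joint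
  smoothness on `[0,T) × ℝ³` alone bounds nothing at spatial infinity. Why it might fail: only by
  mis-typing (`T' < T` strictly; `n ≤ 3` is what stub 2 consumes). NOT rapid decay of `u t` (false for
  `t > 0`: the `|x|⁻⁴` far-field law, tree `tendsto_pow_four_mul_fderiv_normalisedPressure_atTop`).
* `stub_semiconcaveOfBounds` [L, harmonic analysis of the singular integral `p̃ = −|v|²/3 + p.v. K∗(v⊗v)`]:
  ONE constant `K = K(M) ≥ 0` such that every smooth field `v` with `‖Dⁿv‖∞ ≤ M` (`n ≤ 3`) and
  `∫|v|² ≤ M` has `K`-semiconcave normalised pressure. Content: `p̃[v] ∈ C²` with `‖∇²p̃‖∞ ≲ M² + M`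
  (near field `|x−y| < 1`: Calderón–Zygmund on the Lipschitz function `∇²(v⊗v)`, constant `≲ M²`;
  far field: `|∇²K(z)| ≲ |z|⁻⁵` against `|v|² ∈ L¹`, `≲ M`; in tree the far-field Hessian formulas
  `NormalisedPressureFarFieldHessian`, the near/far split `NormalisedPressureDuality`), and
  "`∇²f ≤ K·I` ⇒ `f − K/2‖·‖²` concave" (restriction to lines; Mathlib has the one-variable
  second-derivative test only). Why it might fail: `C²_b` alone would NOT do (CZ fails on `L^∞`), hence
  `n ≤ 3`; with it the statement is a textbook estimate (Stein 1970 III §1; Gilbarg–Trudinger L. 4.4).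
* `stub_subscalingTerminalRate` [XL, OPEN — THE HEART, a transfer of the crux's terminal part to a
  RATE]: on some terminal layer `[T−δ, T)` the ROOT modulus (turnover frequency) is dominated by a
  sub-self-similar clock: `p̃(t) − (C (T−t)^{−α})²/2·‖x‖²` concave with `α < 1`. The self-similar /
  DSS / Leray-scaling clock is `α = 1` exactly (`K ↦ λ⁴K` under NS scaling forces `k ≳ (T−t)⁻²` at a
  self-similar blow-up, the crux's own why-might-fail), which is NOT integrable; every `α < 1` is. So
  the stub says: "near the final time the one-sided pressure Hessian grows strictly slower than
  self-similarly" — the rate currency in which blow-up analysis (Type I/II taxonomy, ε-regularity,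
  the floor lemma `p̃_min ≥ −C E^{2/5}K^{3/5}` of the route, which at Type-I depth forces only
  `α ≥ 5/6`) can attack or refute it; bare integrability cannot be so attacked. It is STRONGER than
  the terminal part of `P` only by non-power-law integrable profiles (e.g. `(T−t)⁻²/log^{2+ε}`), and it
  is not knowingly summit-equivalent: known theory forces `α ≥ 5/6` at a hypothetical Type-I
  singularity, not `α ≥ 1` (route file, crux C docstring). Why it might fail: exactly as the crux —
  any (discretely) self-similar or rotation-dominated Type-I blow-up in the Clay class gives `α = 1`
  (EnergySupercriticality barrier: the bound is critical information from supercritical data; the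
  route's bet is the convex-duality structure of least action, Brenier2020HiddenConvexity Thm 3.1.1,
  ArnaudonEtAl2020, now typable on the torus: `Literature.Analysis.FluidPDE.BrodingerProblem`,
  `HasBrodingerPressure`).

`FinitelyManyTurnovers_of : <sig 1> → <sig 2> → <sig 3> → <the crux statement, verbatim>` is the REAL
composition (closed — axioms `propext`, `Classical.choice`, `Quot.sound`; ≈ 45 lines): take `δ, C, α` from stub 3, `M` from stub 1 at `T' = T − δ`, `K(M)`
from stub 2; the modulus is `k t = K` for `t < T − δ` and `k t = (C (T−t)^{−α})²` on `[T−δ, T)`;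
nonnegativity and slice-wise semiconcavity are the stubs' conclusions (slices of a classical solution
are smooth, `IsClassicalNSSolutionOn.contDiff_velocity`); integrability of `√k` on
`[0,T) = [0,T−δ) ∪ [T−δ,T)`: a constant on a bounded interval, and `√k = C (T−t)^{−α}`
(`Real.sqrt_sq`) with `∫ (T−t)^{−α} < ∞` iff `−α > −1` (Mathlib `intervalIntegral.intervalIntegrable_rpow'`,
`IntervalIntegrable.comp_sub_left`). `FinitelyManyTurnovers_proof : FinitelyManyTurnovers` (the crux BY
NAME, no hypotheses; A12: the ONLY theorem here whose conclusion is the crux by name, hence the one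
`#h21_check_skeleton` takes as THE skeleton) is `FinitelyManyTurnovers_of stub₁ stub₂ stub₃` and
inherits exactly the three registered placeholders. (The conclusion of `FinitelyManyTurnovers_of` is
the crux SPELLED OUT rather than named: with two by-name candidates the audit may pick the
hypothesis-carrying one and report `skeleton.extra-hypothesis`; `FinitelyManyTurnovers_proof`
type-checks against the spelled statement by δ-unfolding of the route's `def`, which certifies that the
spelling is the crux.)

TYPING / VACUITY AUDIT of the stubs. (i) `u ≡ 0` satisfies the frame (tree `isClassicalNSSolutionOn_zero`
/ `isLerayHopfOn_zero`) and all three conclusions hold there (`M = 0`, `p̃[0] = 0` concave, `C = 0`) —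
no stub is vacuous-by-frame and none is refuted by the trivial solution. (ii) `iteratedFDeriv` is junk
only off smooth functions: stub 1 concerns slices of a classical solution (smooth), stub 2 carries
`ContDiff ℝ ∞ v` explicitly (without it the junk `iteratedFDeriv = 0` and the junk `p̃ = 0` of a field
with no principal value would make the statement meaningless). (iii) `normalisedPressure` is non-junk
exactly on `C^∞ ∩ L²` slices (refuter junk audit of 2961, 2026-08-15), which all slices here are.
(iv) `(T − t) ^ (−α)` is `Real.rpow` of a POSITIVE base on `Ico (T−δ) T`; no `0 ^ _` junk is used.
(v) Quantifier order in stub 2 is `∀ M, ∃ K, ∀ v` (a modulus depending on the bounds only) — the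
pointwise `∀ v, ∃ K` would not give a bounded modulus on `[0, T−δ]`. (vi) Stub 3 allows `δ = T`
(then stub 1 is used on `Icc 0 0` only) and `α ≤ 0` (a bounded terminal modulus, the no-blow-up case).

BC3 PROBES (registrar folder `bc/probe_crux.lean`, `bc/probe_summit.lean`; `lean check`,
`maxHeartbeats 400000`, `first | exact? | simpa [S] | (unfold S; simpa) | aesop`): for each stub `S`,
`S → FinitelyManyTurnovers` and `S → NavierStokesRegularity` FAIL (results quoted in `Lines/birth.md`
next to this file) — no stub is cheaply the crux or the summit.

Disproof used: none exists for this crux (`ledger crux ls stmt-NavierStokesRegularity-2961`: no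
workfiles before this one — no `Disproof.lean`, no `Negative/` lemmas, no dead lines); negatives index
(`ledger negatives --problem NavierStokesRegularity`, 4 entries: SymmetryModuliCount tangent moduli,
PerpetualPump averaged datum, AdiabaticEddy corrector, Blowup non-uniqueness) — unrelated; no stub is
an instance of a refuted statement. Leans on (tree, by name): `IsClassicalNSSolutionOn`
(+ `.contDiff_velocity`), `IsLerayHopfOn`, `HasRapidSpatialDecay`, `normalisedPressure`; Mathlib
`ConcaveOn`, `iteratedFDeriv`, `Real.rpow`, `intervalIntegral.intervalIntegrable_rpow'`,
`IntervalIntegrable.comp_sub_left`, `intervalIntegrable_iff_integrableOn_Ioo_of_le`,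
`integrableOn_Ico_iff_integrableOn_Ioo`, `IntegrableOn.congr_fun`, `IntegrableOn.union`, `Real.sqrt_sq`.
-/

noncomputable section

open Set MeasureTheory Filter Topology
open scoped ENNReal NNReal

namespace Summit.NavierStokesRegularity.NavierStokesRegularity.Cruxes.FinitelyManyTurnovers.Birth

set_option linter.unusedVariables false
set_option linter.dupNamespace false

/-- **stub 1 — `stub_aprioriBoundsBeforeT` (L, KNOWN-type: Clay-class a-priori regularity strictly
before the final time).** For the crux's frame (classical on `[0,T)`, Leray–Hopf on `[0,T]`, rapidly
decaying datum) and every `T' < T`: one constant bounds `‖Dⁿ(u t)(x)‖`, `n ≤ 3`, uniformly in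
`x ∈ ℝ³`, and the energy `∫|u t|²`, for all `t ∈ [0,T']` [Kato1984 Thm 1/4; LemarieRieusset2016
Thm 15.1 (C) = tree `lemarieRieusset_singular_point_of_blowup_holds`; weak–strong uniqueness
(tree `weak_strong_uniqueness_holds`); Leray–Hopf energy inequality]. -/
theorem stub_aprioriBoundsBeforeT :
    ∀ (ν T : ℝ), 0 < ν → 0 < T →
      ∀ (u : ℝ → EuclideanSpace ℝ (Fin 3) → EuclideanSpace ℝ (Fin 3)) (p : ℝ → EuclideanSpace ℝ (Fin 3) → ℝ),
      Literature.Analysis.FluidPDE.IsClassicalNSSolutionOn (Set.Ico 0 T) ν 0 u p →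
      Literature.Analysis.FluidPDE.IsLerayHopfOn T ν 0 (u 0) u →
      Literature.Analysis.FluidPDE.HasRapidSpatialDecay (u 0) →
      ∀ T' < T, ∃ M : ℝ, ∀ t ∈ Set.Icc 0 T',
        (∀ n ≤ 3, ∀ x : EuclideanSpace ℝ (Fin 3), ‖iteratedFDeriv ℝ n (u t) x‖ ≤ M) ∧
        (∫⁻ x, ‖u t x‖ₑ ^ 2) ≤ ENNReal.ofReal M := by
  sorry

/-- **stub 2 — `stub_semiconcaveOfBounds` (L, harmonic analysis: the semiconcavity modulus of the
Riesz pressure is controlled by `C³_b ∩ L²` bounds).** For every `M` there is ONE `K = K(M) ≥ 0` such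
that every smooth `v : ℝ³ → ℝ³` with `‖Dⁿv‖∞ ≤ M` (`n ≤ 3`) and `∫|v|² ≤ M` has
`x ↦ p̃[v](x) − K/2·‖x‖²` concave (`‖∇²p̃[v]‖∞ ≲ M² + M`: Calderón–Zygmund near field on the Lipschitz
`∇²(v⊗v)`, `|z|⁻⁵` far-field kernel against `|v|² ∈ L¹`; then the second-derivative test along lines)
[Stein1970 III §1; GilbargTrudinger L. 4.4; Tao2011 (35); tree `NormalisedPressureFarFieldHessian`,
`NormalisedPressureDuality`]. -/
theorem stub_semiconcaveOfBounds :
    ∀ M : ℝ, ∃ K : ℝ, 0 ≤ K ∧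
      ∀ v : EuclideanSpace ℝ (Fin 3) → EuclideanSpace ℝ (Fin 3), ContDiff ℝ (⊤ : ℕ∞) v →
        (∀ n ≤ 3, ∀ x : EuclideanSpace ℝ (Fin 3), ‖iteratedFDeriv ℝ n v x‖ ≤ M) →
        (∫⁻ x, ‖v x‖ₑ ^ 2) ≤ ENNReal.ofReal M →
        ConcaveOn ℝ Set.univ (fun x : EuclideanSpace ℝ (Fin 3) =>
          Literature.Analysis.FluidPDE.normalisedPressure v x - K / 2 * ‖x‖ ^ 2) := by
  sorry

/-- **stub 3 — `stub_subscalingTerminalRate` (XL, OPEN, the heart: sub-self-similar growth of the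
turnover frequency at the final time).** For the crux's frame there are a terminal layer `[T−δ, T)`,
`0 < δ ≤ T`, a constant `C ≥ 0` and an exponent `α < 1` such that every slice `p̃(t)`, `T−δ ≤ t < T`,
is semiconcave with ROOT modulus `C (T−t)^{−α}` — strictly slower than the self-similar clock
`(T−t)⁻¹` (`α = 1`, forced by NS scaling at any self-similar / DSS blow-up and not integrable)
[Brenier2020HiddenConvexity Thm 3.1.1; ArnaudonEtAl2020; SereginSverak2002; the route's floor lemma
gives only `α ≥ 5/6` at Type-I depth; barrier `Literature.Barriers.NavierStokesRegularity.EnergySupercriticality`]. -/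
theorem stub_subscalingTerminalRate :
    ∀ (ν T : ℝ), 0 < ν → 0 < T →
      ∀ (u : ℝ → EuclideanSpace ℝ (Fin 3) → EuclideanSpace ℝ (Fin 3)) (p : ℝ → EuclideanSpace ℝ (Fin 3) → ℝ),
      Literature.Analysis.FluidPDE.IsClassicalNSSolutionOn (Set.Ico 0 T) ν 0 u p →
      Literature.Analysis.FluidPDE.IsLerayHopfOn T ν 0 (u 0) u →
      Literature.Analysis.FluidPDE.HasRapidSpatialDecay (u 0) →
      ∃ (δ C α : ℝ), 0 < δ ∧ δ ≤ T ∧ 0 ≤ C ∧ α < 1 ∧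
        ∀ t ∈ Set.Ico (T - δ) T, ConcaveOn ℝ Set.univ (fun x : EuclideanSpace ℝ (Fin 3) =>
          Literature.Analysis.FluidPDE.normalisedPressure (u t) x - (C * (T - t) ^ (-α)) ^ 2 / 2 * ‖x‖ ^ 2) := by
  sorry

/-- **Birth composition (closed).** The three stub STATEMENTS imply the crux BY NAME: modulus
`k = K(M)` (stubs 1 + 2 at `T' = T − δ`) before the terminal layer and `k = (C (T−t)^{−α})²` on it
(stub 3); `√k` is a constant on `[0, T−δ)` and `C (T−t)^{−α}`, `α < 1`, on `[T−δ, T)` — integrable. -/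
theorem FinitelyManyTurnovers_of :
    (∀ (ν T : ℝ), 0 < ν → 0 < T →
      ∀ (u : ℝ → EuclideanSpace ℝ (Fin 3) → EuclideanSpace ℝ (Fin 3)) (p : ℝ → EuclideanSpace ℝ (Fin 3) → ℝ),
      Literature.Analysis.FluidPDE.IsClassicalNSSolutionOn (Set.Ico 0 T) ν 0 u p →
      Literature.Analysis.FluidPDE.IsLerayHopfOn T ν 0 (u 0) u →
      Literature.Analysis.FluidPDE.HasRapidSpatialDecay (u 0) →
      ∀ T' < T, ∃ M : ℝ, ∀ t ∈ Set.Icc 0 T',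
        (∀ n ≤ 3, ∀ x : EuclideanSpace ℝ (Fin 3), ‖iteratedFDeriv ℝ n (u t) x‖ ≤ M) ∧
        (∫⁻ x, ‖u t x‖ₑ ^ 2) ≤ ENNReal.ofReal M) →
    (∀ M : ℝ, ∃ K : ℝ, 0 ≤ K ∧
      ∀ v : EuclideanSpace ℝ (Fin 3) → EuclideanSpace ℝ (Fin 3), ContDiff ℝ (⊤ : ℕ∞) v →
        (∀ n ≤ 3, ∀ x : EuclideanSpace ℝ (Fin 3), ‖iteratedFDeriv ℝ n v x‖ ≤ M) →
        (∫⁻ x, ‖v x‖ₑ ^ 2) ≤ ENNReal.ofReal M →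
        ConcaveOn ℝ Set.univ (fun x : EuclideanSpace ℝ (Fin 3) =>
          Literature.Analysis.FluidPDE.normalisedPressure v x - K / 2 * ‖x‖ ^ 2)) →
    (∀ (ν T : ℝ), 0 < ν → 0 < T →
      ∀ (u : ℝ → EuclideanSpace ℝ (Fin 3) → EuclideanSpace ℝ (Fin 3)) (p : ℝ → EuclideanSpace ℝ (Fin 3) → ℝ),
      Literature.Analysis.FluidPDE.IsClassicalNSSolutionOn (Set.Ico 0 T) ν 0 u p →
      Literature.Analysis.FluidPDE.IsLerayHopfOn T ν 0 (u 0) u →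
      Literature.Analysis.FluidPDE.HasRapidSpatialDecay (u 0) →
      ∃ (δ C α : ℝ), 0 < δ ∧ δ ≤ T ∧ 0 ≤ C ∧ α < 1 ∧
        ∀ t ∈ Set.Ico (T - δ) T, ConcaveOn ℝ Set.univ (fun x : EuclideanSpace ℝ (Fin 3) =>
          Literature.Analysis.FluidPDE.normalisedPressure (u t) x - (C * (T - t) ^ (-α)) ^ 2 / 2 * ‖x‖ ^ 2)) →
    -- the crux statement `Theses.HiddenConvexityPressureFloor.FinitelyManyTurnovers`, SPELLED OUT verbatim (so that
    -- the audit's by-name slot is held by `FinitelyManyTurnovers_proof` alone; that theorem type-checks against this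
    -- one by δ-unfolding, which certifies the spelling IS the crux):
    ∀ (ν T : ℝ), 0 < ν → 0 < T →
      ∀ (u : ℝ → EuclideanSpace ℝ (Fin 3) → EuclideanSpace ℝ (Fin 3)) (p : ℝ → EuclideanSpace ℝ (Fin 3) → ℝ),
      Literature.Analysis.FluidPDE.IsClassicalNSSolutionOn (Set.Ico 0 T) ν 0 u p →
      Literature.Analysis.FluidPDE.IsLerayHopfOn T ν 0 (u 0) u →
      Literature.Analysis.FluidPDE.HasRapidSpatialDecay (u 0) →
      ∃ k : ℝ → ℝ, (∀ t ∈ Set.Ico 0 T, 0 ≤ k t ∧ ConcaveOn ℝ Set.univ (fun x : EuclideanSpace ℝ (Fin 3) =>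
        Literature.Analysis.FluidPDE.normalisedPressure (u t) x - k t / 2 * ‖x‖ ^ 2)) ∧
        MeasureTheory.IntegrableOn (fun t => Real.sqrt (k t)) (Set.Ico 0 T) := by
  intro h₁ h₂ h₃ ν T hν hT u p hcl hLH hdec
  -- terminal layer and sub-self-similar envelope (stub 3)
  obtain ⟨δ, C, α, hδ, hδT, hC, hα, hterm⟩ := h₃ ν T hν hT u p hcl hLH hdec
  -- a-priori bounds on `[0, T - δ]` (stub 1) and the modulus they buy (stub 2)
  obtain ⟨M, hM⟩ := h₁ ν T hν hT u p hcl hLH hdec (T - δ) (by linarith)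
  obtain ⟨K, hK0, hK⟩ := h₂ M
  refine ⟨fun t => if t < T - δ then K else (C * (T - t) ^ (-α)) ^ 2, ?_, ?_⟩
  · -- nonnegativity and slice-wise semiconcavity
    intro t ht
    by_cases hlt : t < T - δ
    · simp only [if_pos hlt]
      have hsm : ContDiff ℝ (⊤ : ℕ∞) (u t) := hcl.contDiff_velocity ht
      exact ⟨hK0, hK (u t) hsm (hM t ⟨ht.1, hlt.le⟩).1 (hM t ⟨ht.1, hlt.le⟩).2⟩
    · simp only [if_neg hlt]
      exact ⟨sq_nonneg _, hterm t ⟨not_lt.1 hlt, ht.2⟩⟩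
  · -- integrability of `√k` on `[0,T) = [0,T-δ) ∪ [T-δ,T)`
    rw [← Set.Ico_union_Ico_eq_Ico (a := (0 : ℝ)) (b := T - δ) (c := T) (by linarith) (by linarith)]
    refine IntegrableOn.union ?_ ?_
    · -- before the layer: the constant `√K`
      refine IntegrableOn.congr_fun (f := fun _ : ℝ => Real.sqrt K) ?_ ?_ measurableSet_Ico
      · exact integrableOn_const (by rw [Real.volume_Ico]; exact ENNReal.ofReal_ne_top)
      · intro t ht
        simp only [if_pos ht.2]
    · -- on the layer: `√k = C (T - t) ^ (-α)`, integrable iff `-1 < -α`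
      have hr : IntervalIntegrable (fun x : ℝ => x ^ (-α)) volume 0 δ :=
        intervalIntegral.intervalIntegrable_rpow' (by linarith)
      have hr' : IntervalIntegrable (fun x : ℝ => (T - x) ^ (-α)) volume (T - δ) T := by
        simpa only [sub_zero] using (hr.comp_sub_left T).symm
      have hIoo : IntegrableOn (fun x : ℝ => (T - x) ^ (-α)) (Set.Ioo (T - δ) T) volume :=
        (intervalIntegrable_iff_integrableOn_Ioo_of_le (by linarith)).1 hr'
      have hIco : IntegrableOn (fun x : ℝ => (T - x) ^ (-α)) (Set.Ico (T - δ) T) volume := by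
        rwa [integrableOn_Ico_iff_integrableOn_Ioo]
      refine IntegrableOn.congr_fun (f := fun t : ℝ => C * (T - t) ^ (-α)) (hIco.const_mul C) ?_
        measurableSet_Ico
      intro t ht
      have hpos : 0 < T - t := by linarith [ht.2]
      simp only [if_neg (not_lt.2 ht.1)]
      rw [Real.sqrt_sq (mul_nonneg hC (Real.rpow_nonneg hpos.le _))]

/-- **The skeleton in by-name form** (A12 `<Crux>_proof`: the crux BY NAME, no hypotheses — the only
theorem of this file concluding the crux by name, the one `#h21_check_skeleton` takes as THE skeleton):
`FinitelyManyTurnovers_of` applied to the three registered stubs (type-checked against the spelled-out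
conclusion by δ-unfolding of the route's `def`); it inherits exactly their placeholders
(`FinitelyManyTurnovers_of` itself is closed). -/
theorem FinitelyManyTurnovers_proof : Theses.HiddenConvexityPressureFloor.FinitelyManyTurnovers :=
  FinitelyManyTurnovers_of stub_aprioriBoundsBeforeT stub_semiconcaveOfBounds stub_subscalingTerminalRate

end Summit.NavierStokesRegularity.NavierStokesRegularity.Cruxes.FinitelyManyTurnovers.Birth
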